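import Summits.QuantumFields.YangMills.Theorems.BalabanUVNodesN19TargetAtRecord11
import Summits.QuantumFields.YangMills.Theorems.BalabanUVNodesN19CoreKnit

/-!
# YM-DAG node N19 (= NE7 proper) — THE BUDGET ROAD AT THE SPINE CARRIERS OF A STAGE-11 RECORD: node U5's target
# `T4CauchySum.MatchingModConstants vol l₀ δ Z ∧ Summable δ` REDUCED to «weights summable (N20 ∕ N21) + the margin window», with the core matching
# DISPLAYED as a per-term budget and `Σ_K δ_K < ∞` PROVED from the window's letters — an honest RELATIVE closer

Cell `pub-ymgap`, HUMAN RULING D-0062 (Track A), R134 acceleration seat `pub-ymgap-dag-n19-d`, module 3 = the node's NEXT ROW after its own (s2, delivered: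
p450178 ✓ aee4acc7c57a, p451683 ✓ 1fa8b22fbb30): dag-lead FAN-OUT v1.1 §N19 **s3** «BUDGET ROAD: Σδ_K < ∞ from the landed NE7b∕NE7c weights at the spine
carriers (`…N20AtSpineCarriers` p421432, `…N21AtSpineCarriers` p417321) + the per-component∕budget∕criticality files (`…N19MarginByName`, `…MultiplicityByName`,
`…SizeByName`) — matching mod constants REDUCED to «weights summable + margin window» with the core matching displayed; honest relative closer».  Filed
`--supports stmt-QuantumFields-19676` (K3 «SpineGivenEndpointR11»).  COUNT-NEUTRAL; NOT a discharge claim; THEOREMS ONLY, 0 `def`, 0 `sorry`.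

THE REDUCTION (tree names).  Node U5's remainder for the string is `hybridDelta vol δ (W + Wsh) K = δ_K + (−log(1 − W_K − Wsh_K))∕vol`
(`T4HybridMatching.hybridDelta` :442).  Its summability splits into
* the WEIGHT part `Σ_K −log(1 − W_K − Wsh_K) < ∞` ⇐ `0 ≤ W_K + Wsh_K < 1`, `Σ W_K < ∞`, `Σ Wsh_K < ∞` — the fields `nonneg`∕`summable` of N20's
  `T4WeightBudget.RelWeightBound` (NE7b) and N21's `T4IndicatorShell.ShellWeightBound` (NE7c) plus U4′'s budget half (`T4HybridMatching.summable_hybridDelta` :459);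
* the TERM-WISE part `Σ_K δ_K < ∞` — THE MARGIN WINDOW: with the core matching DISPLAYED as a per-term budget
  `T4GoodClassBudget.TermBudget l₀ vol T P Q Bad Cc Rr c₀ r s` (:847: on every good class `e^{Cc − Rr}·P ≤ Q ≤ e^{Cc + Rr}·P`, `P ≥ 0`, `Rr ≤ vol·r_K`,
  `|Cc − c₀ K| ≤ vol·s_K` — ONE class-independent constant `c₀ K` per `K` up to the displayed deviation) whose remainder rate is the window rate of the
  n19-a∕n19-b knits, `r_K = max(Cw,1)·(E₀(K+1)^m + Cr)·Σ_{j+n=K} min(aⁿ, θ′^j Λⁿ) + rO_K` (size letter `E_K = E₀(K+1)^m` = [III] Thm 2 (2.43) AS PRINTED on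
  the recent log window, `N19SizeWindow.sizeBinder_of_thm2Printed` p408948, with the one-run size profile's decay base `a`; `θ′`, `Cr` = node U3's tower rate
  and constant (`T4TermwiseBudget.URateUpTo`); `Cw`, `Λ` = the MULTIPLICITY census constants (`Multiplicity`, (0.26) ∕ (1.26)); `rO` = the other kinds' radii;
  `s` = the centre deviations — the letters of `N19CoreKnit.termBudget_of_towerRate_sizeProfile`), the per-K matching is `Spine.NE7.Core` at
  `δ = r + s` (`N19CoreKnit.core_summable_of_termBudget` p409134 ∕ `T4GoodClassBudget.goodClause_of_termBudget`) and `Σ δ_K < ∞` is PROVED from the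
  window's numerics `0 < a < 1`, `0 < θ′ < 1`, `θ′ ≤ Λ`, `0 ≤ E₀, Cr`, `Σ rO < ∞`, `Σ s < ∞` (`N19CoreKnit.summable_eBranch_windowSize`: comparison with
  `(K+1)^{m+1} q^K`, `q < 1` the crossover rate of `T4Crossover`).
So §1 gives, at ONE family of carriers: the ∃δ-edge with δ EXPLICIT (`core_summable_of_termBudget_window`), the summability of the FULL hybrid remainder from
«weights + window» alone (`summable_hybridDelta_window`), `HybridNE7` with the explicit δ (`hybridNE7_of_termBudget_window` — here the `summable` field is
GENUINE: the window's series, not `summable_deltaOfRecord`), node U5's target with the explicit remainder (`target_of_termBudget_window`,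
`HybridNE7.matchingModConstants` :183 BY NAME); §2 at a Wilson scheme ∕ the datum's scheme (module 1's `matching_schemeZ_of_coreEdge` ∕ `matching_scheme_of_coreEdge`);
§3 at every `Node00.IsRecordOfRecord₁₁C` record from the cluster stub texts `S_N27x` · `S_N20` · `S_N21` · U4′'s budget half and a TERM-BUDGET READING of
the record («`SRec ∧ Inputs` hand, with every bundle, the displayed per-term budget at the shell-free cores with window letters and numerics») — the relative
closer (`matching_at_record₁₁_of_termBudgetReading`, `matchingUnder_at_record₁₁_of_termBudgetReading` with K4 consumed); §3′ the same target at the Stage-11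
DATUM `Node00.datumOfRecord₁₁ F N θ h` WORLD-FREE and θ-KEYED — the sentence a `cr`-keyed spine-record home (RR-1's `IsRateKey₁₁` ∕ n20-e's `keyed₁₁` convention)
instantiates — in both currencies (`matching_datumOfRecord₁₁_of_coreEdge`, `matching_datumOfRecord₁₁_of_termBudget_window`; `AvgMeasurable` from B1 at the datum,
`Node00.isPrintedAveraged_datumOfRecord₁₁`); §4 sanity.

HONEST FRAMING.  A RELATIVE closer: the per-term budget (= NE7's term-wise half in displayed form), the window letters, N20 ∕ N21 ∕ N27x ∕ U4′-budget and
`SRec` ∕ `Inputs` are HYPOTHESES ∕ PARAMETERS with no producer at the record today; what is PROVED is only the reduction «weights summable + margin window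
⇒ Σ hybridDelta < ∞ ⇒ U5's target», elementary series bookkeeping over tree theorems BY NAME.  NE7 is NOT PRINTED and NOT PROVED; nothing of
Bałaban's is asserted or instantiated; N19 NOT discharged; Track A count unmoved (5∕27).  One finite four-torus at fixed ε, rung (B)+1 — NOT infinite
volume, NOT OS on ℝ⁴, NOT a mass gap, NOT Clay.  Locators (context only): [Balaban1988Convergent] Thm 2 (2.43) p. 263 (size letter), (2.27)(ii)–(2.28)
p. 259 (margin); [King1986] (3.10)–(3.13) pp. 656–657 (template of the target).
-/

set_option autoImplicit false

noncomputable section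

open Finset MeasureTheory
open scoped BigOperators

namespace Summit.QuantumFields.YangMills.BalabanUVNodes.N19BudgetRoadAtRecord11

open Literature.MathematicalPhysics.QuantumFieldTheory.Balaban1983to89
open Literature.MathematicalPhysics.QuantumFieldTheory.Balaban1983to89.T4Continuum
open T4WeightBudget (RelWeightBound)
open T4IndicatorShell (ShellWeightBound)
open T4GoodClassBudget (TermBudget)
open T4MatchingAssembly (HybridNE7)
open T4HybridMatching (hybridDelta summable_hybridDelta)
open T4CauchySum (MatchingModConstants)
open T4ContinuumYM4Torus (ForSmallCouplings)
open T4ApexVariance (StringwiseMatching MatchingUnder)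
open Summit.QuantumFields.BalabanUV.T4Continuum.Spine
open Summit.QuantumFields.YangMills.BalabanUVNodes.N19CoreKnit (core_summable_of_termBudget summable_eBranch_windowSize)
open Summit.QuantumFields.YangMills.BalabanUVNodes.N19TargetAtRecord11 (matching_schemeZ_of_coreEdge matching_scheme_of_coreEdge
  matching_at_record₁₁_of_coreEdge stringwiseMatching_at_record₁₁_of_spineRates)
open YMDAG.UVSplit (Datum SpineCarriers SpineRecordPred InputsPred S_N27x S_N20 S_N21 SpineRates)

/-! ## §1 At one family of carriers: the per-term budget on the margin window ⇒ explicit summable remainder ⇒ `HybridNE7` ⇒ U5's target -/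

section Carriers

variable {ι : Type*} [DecidableEq ι] {l₀ vol : ℝ} {T : ℕ → Finset ι} {P Q A B shA shB : ℕ → ℝ → ι → ℝ} {Bad : ℕ → ℝ → Finset ι}
  {W Wsh : ℕ → ℝ} {Cc Rr : ℕ → ℝ → ι → ℝ} {c₀ rO s : ℕ → ℝ} {Cw E₀ Cr a θ' Λg : ℝ} {m : ℕ}

/-- **THE MARGIN WINDOW ⇒ N19 ∧ U4′ WITH AN EXPLICIT REMAINDER** [bookkeeping].  The core matching DISPLAYED as a per-term budget on the good classes with
the window remainder rate `r_K = max(Cw,1)·(E₀(K+1)^m + Cr)·Σ_{j+n=K} min(aⁿ, θ′^jΛⁿ) + rO_K` and centre deviations `s`, and the window's numerics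
`0 ≤ E₀, Cr`, `0 < a < 1`, `0 < θ′ < 1`, `θ′ ≤ Λ`, `Σ rO < ∞`, `Σ s < ∞` give `Spine.NE7.Core … (r + s)` AND `Summable (r + s)` —
`N19CoreKnit.core_summable_of_termBudget` with its E-branch hypothesis DISCHARGED by `N19CoreKnit.summable_eBranch_windowSize`. [folklore] -/
theorem core_summable_of_termBudget_window
    (hT : TermBudget l₀ vol T P Q Bad Cc Rr c₀
      (fun K : ℕ => max Cw 1 * ((E₀ * ((K : ℝ) + 1) ^ m + Cr) * ∑ x ∈ antidiagonal K, min (a ^ x.2) (θ' ^ x.1 * Λg ^ x.2)) + rO K) s)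
    (hE₀ : 0 ≤ E₀) (hCr : 0 ≤ Cr) (ha0 : 0 < a) (ha1 : a < 1) (hθ'0 : 0 < θ') (hθ'1 : θ' < 1) (hθ'Λ : θ' ≤ Λg)
    (hrO : Summable rO) (hs : Summable s) :
    NE7.Core l₀ vol T Bad P Q
        (fun K : ℕ => (max Cw 1 * ((E₀ * ((K : ℝ) + 1) ^ m + Cr) * ∑ x ∈ antidiagonal K, min (a ^ x.2) (θ' ^ x.1 * Λg ^ x.2)) + rO K)
          + s K) ∧
      Summable (fun K : ℕ => (max Cw 1 * ((E₀ * ((K : ℝ) + 1) ^ m + Cr) * ∑ x ∈ antidiagonal K, min (a ^ x.2) (θ' ^ x.1 * Λg ^ x.2))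
          + rO K) + s K) :=
  core_summable_of_termBudget (E := fun K => E₀ * ((K : ℝ) + 1) ^ m) hT
    (summable_eBranch_windowSize hE₀ hCr ha0 ha1 hθ'0 hθ'1 hθ'Λ) hrO hs

omit [DecidableEq ι] in
/-- **«WEIGHTS SUMMABLE + MARGIN WINDOW» ⇒ THE FULL HYBRID REMAINDER IS SUMMABLE** [bookkeeping] — no matching is read: N20's `nonneg`∕`summable`,
N21's `nonneg`∕`summable`, U4′'s budget half `W + Wsh < 1` and the window numerics give
`Summable (hybridDelta vol (r + s) (W + Wsh))` (`T4HybridMatching.summable_hybridDelta`). [folklore] -/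
theorem summable_hybridDelta_window (h20 : RelWeightBound l₀ T A B Bad W) (h21 : ShellWeightBound l₀ T A B shA shB Wsh)
    (hlt : ∀ K, W K + Wsh K < 1)
    (hE₀ : 0 ≤ E₀) (hCr : 0 ≤ Cr) (ha0 : 0 < a) (ha1 : a < 1) (hθ'0 : 0 < θ') (hθ'1 : θ' < 1) (hθ'Λ : θ' ≤ Λg)
    (hrO : Summable rO) (hs : Summable s) :
    Summable (hybridDelta vol
      (fun K : ℕ => (max Cw 1 * ((E₀ * ((K : ℝ) + 1) ^ m + Cr) * ∑ x ∈ antidiagonal K, min (a ^ x.2) (θ' ^ x.1 * Λg ^ x.2)) + rO K)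
        + s K)
      fun K => W K + Wsh K) :=
  summable_hybridDelta ((((summable_eBranch_windowSize hE₀ hCr ha0 ha1 hθ'0 hθ'1 hθ'Λ).mul_left (max Cw 1)).add hrO).add hs)
    (fun K => add_nonneg (h20.nonneg K) (h21.nonneg K)) hlt (h20.summable.add h21.summable)

/-- **`HybridNE7` ON THE BUDGET ROAD, REMAINDER EXPLICIT** [bookkeeping]: N20 · N21 · U4′'s budget half · the per-term budget on the margin window ⇒
`HybridNE7 … (r + s)` — here the `summable` field is the window's GENUINE series (contrast module 1's `summable_deltaOfRecord`).  `Spine.NE7.hybridNE7_of_core`.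
[folklore] -/
theorem hybridNE7_of_termBudget_window (h20 : RelWeightBound l₀ T A B Bad W) (h21 : ShellWeightBound l₀ T A B shA shB Wsh)
    (hlt : ∀ K, W K + Wsh K < 1)
    (hT : TermBudget l₀ vol T (fun K t τ => A K t τ - shA K t τ) (fun K t τ => B K t τ - shB K t τ) Bad Cc Rr c₀
      (fun K : ℕ => max Cw 1 * ((E₀ * ((K : ℝ) + 1) ^ m + Cr) * ∑ x ∈ antidiagonal K, min (a ^ x.2) (θ' ^ x.1 * Λg ^ x.2)) + rO K) s)
    (hE₀ : 0 ≤ E₀) (hCr : 0 ≤ Cr) (ha0 : 0 < a) (ha1 : a < 1) (hθ'0 : 0 < θ') (hθ'1 : θ' < 1) (hθ'Λ : θ' ≤ Λg)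
    (hrO : Summable rO) (hs : Summable s) :
    HybridNE7 l₀ vol T A B Bad W shA shB Wsh
      (fun K : ℕ => (max Cw 1 * ((E₀ * ((K : ℝ) + 1) ^ m + Cr) * ∑ x ∈ antidiagonal K, min (a ^ x.2) (θ' ^ x.1 * Λg ^ x.2)) + rO K)
        + s K) :=
  let h := core_summable_of_termBudget_window hT hE₀ hCr ha0 ha1 hθ'0 hθ'1 hθ'Λ hrO hs
  NE7.hybridNE7_of_core h20 h21 hlt h.2 h.1

/-- **NODE U5's TARGET ON THE BUDGET ROAD, REMAINDER EXPLICIT** [bookkeeping]: with the E1∕E2 dictionary to a sequence `Z` from `K₀` and positivity,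
`Spine.NE7.Target vol l₀ (hybridDelta vol (r + s) (W + Wsh)) (K ↦ Z (K₀ + K))` — matching modulo constants with the remainder whose summability IS
«weights summable + margin window» (`HybridNE7.matchingModConstants` :183 BY NAME). [folklore] -/
theorem target_of_termBudget_window {Z : ℕ → ℝ → ℝ} {K₀ : ℕ} (h20 : RelWeightBound l₀ T A B Bad W)
    (h21 : ShellWeightBound l₀ T A B shA shB Wsh) (hlt : ∀ K, W K + Wsh K < 1)
    (hT : TermBudget l₀ vol T (fun K t τ => A K t τ - shA K t τ) (fun K t τ => B K t τ - shB K t τ) Bad Cc Rr c₀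
      (fun K : ℕ => max Cw 1 * ((E₀ * ((K : ℝ) + 1) ^ m + Cr) * ∑ x ∈ antidiagonal K, min (a ^ x.2) (θ' ^ x.1 * Λg ^ x.2)) + rO K) s)
    (hE₀ : 0 ≤ E₀) (hCr : 0 ≤ Cr) (ha0 : 0 < a) (ha1 : a < 1) (hθ'0 : 0 < θ') (hθ'1 : θ' < 1) (hθ'Λ : θ' ≤ Λg)
    (hrO : Summable rO) (hs : Summable s) (hvol : 0 < vol) (hl₀ : 0 ≤ l₀)
    (hZA : ∀ (K : ℕ) (t : ℝ), |t| ≤ l₀ → Z (K₀ + K) t = ∑ τ ∈ T K, A K t τ)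
    (hZB : ∀ (K : ℕ) (t : ℝ), |t| ≤ l₀ → Z (K₀ + K + 1) t = ∑ τ ∈ T K, B K t τ)
    (hpos : ∀ (K : ℕ) (t : ℝ), |t| ≤ l₀ → 0 < ∑ τ ∈ T K, A K t τ) :
    NE7.Target vol l₀
      (hybridDelta vol
        (fun K : ℕ => (max Cw 1 * ((E₀ * ((K : ℝ) + 1) ^ m + Cr) * ∑ x ∈ antidiagonal K, min (a ^ x.2) (θ' ^ x.1 * Λg ^ x.2)) + rO K)
          + s K)
        fun K => W K + Wsh K)
      fun K => Z (K₀ + K) :=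
  (hybridNE7_of_termBudget_window h20 h21 hlt hT hE₀ hCr ha0 ha1 hθ'0 hθ'1 hθ'Λ hrO hs).matchingModConstants
    (Z := fun K => Z (K₀ + K)) hvol hl₀ hZA (fun K t ht => by simpa only [Nat.add_assoc] using hZB K t ht) hpos

end Carriers

/-! ## §2 At a Wilson scheme ∕ the datum's scheme: positivity discharged, head free -/

section Scheme

variable {G : Type*} [GaugeGroup G] [MeasurableSpace G] [RegularGaugeGroup G] [HaarData G] {O : Type*}
variable {ι : Type} [DecidableEq ι] {l₀ vol : ℝ} {T : ℕ → Finset ι} {A B shA shB : ℕ → ℝ → ι → ℝ} {Bad : ℕ → ℝ → Finset ι}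
  {W Wsh : ℕ → ℝ} {Cc Rr : ℕ → ℝ → ι → ℝ} {c₀ rO s : ℕ → ℝ} {Cw E₀ Cr a θ' Λg : ℝ} {m : ℕ}

/-- **U5's PER-STRING OUTPUT ON THE BUDGET ROAD AT A WILSON SCHEME** [bookkeeping] (`β_K ≥ 0`, measurable observables bounded by `1`): N20 · N21 · U4′'s
budget half · the per-term budget on the margin window · E1∕E2 ⇒ `∃ δ′, Summable δ′ ∧ MatchingModConstants vol l₀ δ′ (schemeZ S os)` — module 1's
`matching_schemeZ_of_coreEdge` on §1's ∃δ-edge. [folklore] -/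
theorem matching_schemeZ_of_termBudget_window (S : Missing.TorusScheme G O) (hβ : ∀ K, 0 ≤ S.β K)
    (hm : ∀ K o, Measurable (S.obs K o)) (h1 : ∀ K o U, |S.obs K o U| ≤ 1) (os : List O) {K₀ : ℕ} (hl₀ : 0 ≤ l₀)
    (hvol : 0 < vol) (h20 : RelWeightBound l₀ T A B Bad W) (h21 : ShellWeightBound l₀ T A B shA shB Wsh)
    (hlt : ∀ K, W K + Wsh K < 1)
    (hT : TermBudget l₀ vol T (fun K t τ => A K t τ - shA K t τ) (fun K t τ => B K t τ - shB K t τ) Bad Cc Rr c₀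
      (fun K : ℕ => max Cw 1 * ((E₀ * ((K : ℝ) + 1) ^ m + Cr) * ∑ x ∈ antidiagonal K, min (a ^ x.2) (θ' ^ x.1 * Λg ^ x.2)) + rO K) s)
    (hE₀ : 0 ≤ E₀) (hCr : 0 ≤ Cr) (ha0 : 0 < a) (ha1 : a < 1) (hθ'0 : 0 < θ') (hθ'1 : θ' < 1) (hθ'Λ : θ' ≤ Λg)
    (hrO : Summable rO) (hs : Summable s)
    (hE1 : ∀ (K : ℕ) (t : ℝ), |t| ≤ l₀ → T4GenFunBounds.schemeZ S os (K₀ + K) t = ∑ τ ∈ T K, A K t τ)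
    (hE2 : ∀ (K : ℕ) (t : ℝ), |t| ≤ l₀ → T4GenFunBounds.schemeZ S os (K₀ + K + 1) t = ∑ τ ∈ T K, B K t τ) :
    ∃ δ' : ℕ → ℝ, Summable δ' ∧ MatchingModConstants vol l₀ δ' (T4GenFunBounds.schemeZ S os) :=
  matching_schemeZ_of_coreEdge S hβ hm h1 os hl₀ hvol h20 h21 hlt
    ⟨_, core_summable_of_termBudget_window hT hE₀ hCr ha0 ha1 hθ'0 hθ'1 hθ'Λ hrO hs⟩ hE1 hE2

/-- … and at the Wilson scheme `D.scheme g₀` of a finite-`ε` datum with measurable averaging maps. [bookkeeping] [folklore] -/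
theorem matching_scheme_of_termBudget_window {F : T4Family} (D : FiniteEpsData F G) (hM : D.AvgMeasurable) (g₀ : ℕ → ℝ)
    (os : List (ULoop F)) {K₀ : ℕ} (hl₀ : 0 ≤ l₀) (hvol : 0 < vol) (h20 : RelWeightBound l₀ T A B Bad W)
    (h21 : ShellWeightBound l₀ T A B shA shB Wsh) (hlt : ∀ K, W K + Wsh K < 1)
    (hT : TermBudget l₀ vol T (fun K t τ => A K t τ - shA K t τ) (fun K t τ => B K t τ - shB K t τ) Bad Cc Rr c₀
      (fun K : ℕ => max Cw 1 * ((E₀ * ((K : ℝ) + 1) ^ m + Cr) * ∑ x ∈ antidiagonal K, min (a ^ x.2) (θ' ^ x.1 * Λg ^ x.2)) + rO K) s)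
    (hE₀ : 0 ≤ E₀) (hCr : 0 ≤ Cr) (ha0 : 0 < a) (ha1 : a < 1) (hθ'0 : 0 < θ') (hθ'1 : θ' < 1) (hθ'Λ : θ' ≤ Λg)
    (hrO : Summable rO) (hs : Summable s)
    (hE1 : ∀ (K : ℕ) (t : ℝ), |t| ≤ l₀ → T4GenFunBounds.schemeZ (D.scheme g₀) os (K₀ + K) t = ∑ τ ∈ T K, A K t τ)
    (hE2 : ∀ (K : ℕ) (t : ℝ), |t| ≤ l₀ → T4GenFunBounds.schemeZ (D.scheme g₀) os (K₀ + K + 1) t = ∑ τ ∈ T K, B K t τ) :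
    ∃ δ' : ℕ → ℝ, Summable δ' ∧ MatchingModConstants vol l₀ δ' (T4GenFunBounds.schemeZ (D.scheme g₀) os) :=
  matching_scheme_of_coreEdge D hM g₀ os hl₀ hvol h20 h21 hlt
    ⟨_, core_summable_of_termBudget_window hT hE₀ hCr ha0 ha1 hθ'0 hθ'1 hθ'Λ hrO hs⟩ hE1 hE2

end Scheme

/-! ## §3 The relative closer at the Stage-11 record: a TERM-BUDGET READING of the record ⇒ N19's DECL target at every ₁₁ record -/

section Record

variable {N : ℕ} [NeZero N]

/-- **THE BUDGET ROAD AT EVERY STAGE-11 RECORD, GUARDED BY K4's CONCLUSION** [bookkeeping].  Over `fun F D w ↦ Node00.IsRecordOfRecord₁₁C F N D w`, for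
PARAMETERS `SRec`, `Inputs`: `S_N27x` (expansion of record + E1∕E2) · `S_N20` (NE7b — weights) · `S_N21` (NE7c — shells) · U4′'s budget half, and a
TERM-BUDGET READING — with every bundle `S` and K4's conclusion, `SRec ∧ Inputs` hand the DISPLAYED per-term budget at the shell-free cores
(`TermBudget S.l₀ S.vol S.T (A − shA) (B − shB) S.Bad Cc Rr c₀ r s` with the window rate `r`) and the window's letters and numerics — give, at every ₁₁ record with
(B) and END, for all small-coupling tuned runs and every string carrying `Inputs`: `∃ l₀ vol δ′, 0 < l₀ ∧ Summable δ′ ∧ MatchingModConstants vol l₀ δ′ (schemeZ (D.scheme g₀) os)`.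
Module 1's `matching_at_record₁₁_of_coreEdge` on §1's explicit ∃δ-edge; `AvgMeasurable` from the record.  RELATIVE: the budget reading is the hypothesis. [folklore] -/
theorem matching_at_record₁₁_of_termBudgetReading (SRec : SpineRecordPred N) (Inputs : InputsPred N)
    (hx : S_N27x (fun F D w => Node00.IsRecordOfRecord₁₁C F N D w) SRec) (h20 : S_N20 SRec) (h21 : S_N21 SRec)
    (hlt : ∀ (F : T4Family) (D : Datum F N) (g₀ : ℕ → ℝ) (os : List (ULoop F)) (S : SpineCarriers),
      SRec F D g₀ os S → ∀ K, S.W K + S.Wsh K < 1)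
    (hbud : ∀ (F : T4Family) (D : Datum F N) (g₀ : ℕ → ℝ) (os : List (ULoop F)) (S : SpineCarriers),
      SRec F D g₀ os S → Inputs F D g₀ os → letI := S.dec
      ∃ (Cc Rr : ℕ → ℝ → S.ι → ℝ) (c₀ rO s : ℕ → ℝ) (Cw E₀ Cr a θ' Λg : ℝ) (m : ℕ),
        TermBudget S.l₀ S.vol S.T (fun K t τ => S.A K t τ - S.shA K t τ) (fun K t τ => S.B K t τ - S.shB K t τ) S.Bad Cc Rr c₀
          (fun K : ℕ => max Cw 1 * ((E₀ * ((K : ℝ) + 1) ^ m + Cr) * ∑ x ∈ antidiagonal K, min (a ^ x.2) (θ' ^ x.1 * Λg ^ x.2)) + rO K)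
          s ∧
        0 ≤ E₀ ∧ 0 ≤ Cr ∧ 0 < a ∧ a < 1 ∧ 0 < θ' ∧ θ' < 1 ∧ θ' ≤ Λg ∧ Summable rO ∧ Summable s)
    {F : T4Family} {D : Datum F N} {w : DagBinding.WorldP} (hR : Node00.IsRecordOfRecord₁₁C F N D w)
    (hB : B16.EndStatementBPrinted D.C) (hE : DagBinding.EndpointExistence D.C.toB12) :
    ForSmallCouplings D fun g₀ => ∀ os : List (ULoop F), Inputs F D g₀ os →
      ∃ (l₀ vol : ℝ) (δ' : ℕ → ℝ), 0 < l₀ ∧ Summable δ' ∧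
        MatchingModConstants vol l₀ δ' (T4GenFunBounds.schemeZ (D.scheme g₀) os) :=
  matching_at_record₁₁_of_coreEdge SRec Inputs hx h20 h21 hlt (fun F D g₀ os S hS hI => by
    letI := S.dec
    obtain ⟨Cc, Rr, c₀, rO, s, Cw, E₀, Cr, a, θ', Λg, m, hT, hE₀, hCr, ha0, ha1, hθ'0, hθ'1, hθ'Λ, hrO, hs⟩ :=
      hbud F D g₀ os S hS hI
    exact ⟨_, core_summable_of_termBudget_window hT hE₀ hCr ha0 ha1 hθ'0 hθ'1 hθ'Λ hrO hs⟩) hR hB hE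

/-- **… K4 CONSUMED, IN THE NAME `T4ApexVariance.MatchingUnder D END`** [bookkeeping]: with K4's hook `SpineRates Rec₁₁ Inputs` the budget road gives N19's DECL
target under the prefix at every ₁₁ record (module 1's `stringwiseMatching_at_record₁₁_of_spineRates`). [folklore] -/
theorem matchingUnder_at_record₁₁_of_termBudgetReading (SRec : SpineRecordPred N) (Inputs : InputsPred N)
    (hx : S_N27x (fun F D w => Node00.IsRecordOfRecord₁₁C F N D w) SRec) (h20 : S_N20 SRec) (h21 : S_N21 SRec)
    (hlt : ∀ (F : T4Family) (D : Datum F N) (g₀ : ℕ → ℝ) (os : List (ULoop F)) (S : SpineCarriers),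
      SRec F D g₀ os S → ∀ K, S.W K + S.Wsh K < 1)
    (hbud : ∀ (F : T4Family) (D : Datum F N) (g₀ : ℕ → ℝ) (os : List (ULoop F)) (S : SpineCarriers),
      SRec F D g₀ os S → Inputs F D g₀ os → letI := S.dec
      ∃ (Cc Rr : ℕ → ℝ → S.ι → ℝ) (c₀ rO s : ℕ → ℝ) (Cw E₀ Cr a θ' Λg : ℝ) (m : ℕ),
        TermBudget S.l₀ S.vol S.T (fun K t τ => S.A K t τ - S.shA K t τ) (fun K t τ => S.B K t τ - S.shB K t τ) S.Bad Cc Rr c₀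
          (fun K : ℕ => max Cw 1 * ((E₀ * ((K : ℝ) + 1) ^ m + Cr) * ∑ x ∈ antidiagonal K, min (a ^ x.2) (θ' ^ x.1 * Λg ^ x.2)) + rO K)
          s ∧
        0 ≤ E₀ ∧ 0 ≤ Cr ∧ 0 < a ∧ a < 1 ∧ 0 < θ' ∧ θ' < 1 ∧ θ' ≤ Λg ∧ Summable rO ∧ Summable s)
    (h4 : SpineRates (fun F D w => Node00.IsRecordOfRecord₁₁C F N D w) Inputs)
    {F : T4Family} {D : Datum F N} {w : DagBinding.WorldP} (hR : Node00.IsRecordOfRecord₁₁C F N D w) :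
    MatchingUnder D (DagBinding.EndpointExistence D.C.toB12) :=
  stringwiseMatching_at_record₁₁_of_spineRates SRec Inputs hx h20 h21 hlt (fun F D g₀ os S hS hI => by
    letI := S.dec
    obtain ⟨Cc, Rr, c₀, rO, s, Cw, E₀, Cr, a, θ', Λg, m, hT, hE₀, hCr, ha0, ha1, hθ'0, hθ'1, hθ'Λ, hrO, hs⟩ :=
      hbud F D g₀ os S hS hI
    exact ⟨_, core_summable_of_termBudget_window hT hE₀ hCr ha0 ha1 hθ'0 hθ'1 hθ'Λ hrO hs⟩) h4 hR

end Record

/-! ## §3′ At the Stage-11 DATUM `Node00.datumOfRecord₁₁ F N θ h` (world-free, θ-keyed — the form the rate-record home keys to, RR-1 `IsRateKey₁₁`) -/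

section Datum

variable {N : ℕ} [NeZero N] {F : T4Family}
variable {ι : Type} [DecidableEq ι] {l₀ vol : ℝ} {T : ℕ → Finset ι} {A B shA shB : ℕ → ℝ → ι → ℝ} {Bad : ℕ → ℝ → Finset ι}
  {W Wsh : ℕ → ℝ} {Cc Rr : ℕ → ℝ → ι → ℝ} {c₀ rO s : ℕ → ℝ} {Cw E₀ Cr a θ' Λg : ℝ} {m : ℕ}

/-- **N19's DECL TARGET AT A STAGE-11 DATUM OF RECORD, ∃δ-EDGE FORM, WORLD-FREE** [bookkeeping]: for an admissible-or-not Stage-11 parameter tuple `θ` WITH ITS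
PROVISOS `h`, a bare sequence `g₀`, a loop string `os`, and carriers with `0 ≤ l₀`, `0 < vol`, N20 · N21 · U4′'s budget half · N19's ∃δ-edge · E1∕E2 against
`schemeZ ((datumOfRecord₁₁ F N θ h).scheme g₀) os`: `∃ δ′, Summable δ′ ∧ MatchingModConstants vol l₀ δ′ (schemeZ …)` — module 1's `matching_scheme_of_coreEdge` with
`AvgMeasurable` from B1 at the datum (`Node00.isPrintedAveraged_datumOfRecord₁₁`).  No world, no record predicate: the θ-keyed sentence a `cr`-keyed spine-record
home instantiates (n20-e's `s_N20_keyed₁₁_iff` convention). [folklore] -/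
theorem matching_datumOfRecord₁₁_of_coreEdge (θ : Node00.Stage11Params F N) (h : θ.Provisos₁₁) (g₀ : ℕ → ℝ) (os : List (ULoop F)) {K₀ : ℕ}
    (hl₀ : 0 ≤ l₀) (hvol : 0 < vol) (h20 : RelWeightBound l₀ T A B Bad W) (h21 : ShellWeightBound l₀ T A B shA shB Wsh)
    (hlt : ∀ K, W K + Wsh K < 1)
    (hedge : ∃ δ : ℕ → ℝ, NE7.Core l₀ vol T Bad (fun K t τ => A K t τ - shA K t τ) (fun K t τ => B K t τ - shB K t τ) δ ∧ Summable δ)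
    (hE1 : ∀ (K : ℕ) (t : ℝ), |t| ≤ l₀ →
      T4GenFunBounds.schemeZ ((Node00.datumOfRecord₁₁ F N θ h).scheme g₀) os (K₀ + K) t = ∑ τ ∈ T K, A K t τ)
    (hE2 : ∀ (K : ℕ) (t : ℝ), |t| ≤ l₀ →
      T4GenFunBounds.schemeZ ((Node00.datumOfRecord₁₁ F N θ h).scheme g₀) os (K₀ + K + 1) t = ∑ τ ∈ T K, B K t τ) :
    ∃ δ' : ℕ → ℝ, Summable δ' ∧ MatchingModConstants vol l₀ δ' (T4GenFunBounds.schemeZ ((Node00.datumOfRecord₁₁ F N θ h).scheme g₀) os) :=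
  matching_scheme_of_coreEdge (Node00.datumOfRecord₁₁ F N θ h) (Node00.isPrintedAveraged_datumOfRecord₁₁ F N θ h).avgMeasurable g₀ os hl₀ hvol
    h20 h21 hlt hedge hE1 hE2

/-- **… AND ON THE BUDGET ROAD** [bookkeeping]: the same with the ∃δ-edge replaced by the DISPLAYED per-term budget on the margin window and its numerics (§1). [folklore] -/
theorem matching_datumOfRecord₁₁_of_termBudget_window (θ : Node00.Stage11Params F N) (h : θ.Provisos₁₁) (g₀ : ℕ → ℝ) (os : List (ULoop F))
    {K₀ : ℕ} (hl₀ : 0 ≤ l₀) (hvol : 0 < vol) (h20 : RelWeightBound l₀ T A B Bad W) (h21 : ShellWeightBound l₀ T A B shA shB Wsh)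
    (hlt : ∀ K, W K + Wsh K < 1)
    (hT : TermBudget l₀ vol T (fun K t τ => A K t τ - shA K t τ) (fun K t τ => B K t τ - shB K t τ) Bad Cc Rr c₀
      (fun K : ℕ => max Cw 1 * ((E₀ * ((K : ℝ) + 1) ^ m + Cr) * ∑ x ∈ antidiagonal K, min (a ^ x.2) (θ' ^ x.1 * Λg ^ x.2)) + rO K) s)
    (hE₀ : 0 ≤ E₀) (hCr : 0 ≤ Cr) (ha0 : 0 < a) (ha1 : a < 1) (hθ'0 : 0 < θ') (hθ'1 : θ' < 1) (hθ'Λ : θ' ≤ Λg)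
    (hrO : Summable rO) (hs : Summable s)
    (hE1 : ∀ (K : ℕ) (t : ℝ), |t| ≤ l₀ →
      T4GenFunBounds.schemeZ ((Node00.datumOfRecord₁₁ F N θ h).scheme g₀) os (K₀ + K) t = ∑ τ ∈ T K, A K t τ)
    (hE2 : ∀ (K : ℕ) (t : ℝ), |t| ≤ l₀ →
      T4GenFunBounds.schemeZ ((Node00.datumOfRecord₁₁ F N θ h).scheme g₀) os (K₀ + K + 1) t = ∑ τ ∈ T K, B K t τ) :
    ∃ δ' : ℕ → ℝ, Summable δ' ∧ MatchingModConstants vol l₀ δ' (T4GenFunBounds.schemeZ ((Node00.datumOfRecord₁₁ F N θ h).scheme g₀) os) :=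
  matching_datumOfRecord₁₁_of_coreEdge θ h g₀ os hl₀ hvol h20 h21 hlt
    ⟨_, core_summable_of_termBudget_window hT hE₀ hCr ha0 ha1 hθ'0 hθ'1 hθ'Λ hrO hs⟩ hE1 hE2

end Datum

/-! ## §4 Sanity: the per-term budget is inhabited on the trivial carriers (no content) -/

/-- SANITY [folklore]: one class, both shell-free cores `≡ 1`, no bad class, term constants `Cc = 0`, `Rr = 0`, `c₀ = 0`, `rO = s = 0`, window letters
`Cw = 1`, `E₀ = 0`, `Cr = 0`, `a = θ′ = Λ = 1∕2`, `m = 0`: the per-term budget holds (`e^0·1 ≤ 1 ≤ e^0·1`, remainder `0 ≤ vol·r_K` since `r_K ≥ 0`), and §1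
fires.  Joint satisfiability only. [folklore] -/
example : ∃ δ : ℕ → ℝ, NE7.Core (1 : ℝ) 1 (fun _ => ({()} : Finset Unit)) (fun _ _ => ∅) (fun _ _ _ => (1 : ℝ)) (fun _ _ _ => (1 : ℝ)) δ ∧
    Summable δ := by
  have hT : TermBudget (1 : ℝ) 1 (fun _ => ({()} : Finset Unit)) (fun _ _ _ => (1 : ℝ)) (fun _ _ _ => (1 : ℝ)) (fun _ _ => ∅)
      (fun _ _ _ => 0) (fun _ _ _ => 0) (fun _ => 0)
      (fun K : ℕ => max (1 : ℝ) 1 * (((0 : ℝ) * ((K : ℝ) + 1) ^ (0 : ℕ) + 0) *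
        ∑ x ∈ antidiagonal K, min ((1 / 2 : ℝ) ^ x.2) ((1 / 2 : ℝ) ^ x.1 * (1 / 2 : ℝ) ^ x.2)) + (fun _ => (0 : ℝ)) K)
      (fun _ => 0) :=
    { nonneg := fun _ _ _ _ _ => zero_le_one
      lower := fun _ _ _ _ _ => by simp
      upper := fun _ _ _ _ _ => by simp
      remainder := fun K _ _ _ _ => by simp
      deviation := fun _ _ _ _ _ => by simp }
  exact ⟨_, core_summable_of_termBudget_window hT le_rfl le_rfl (by norm_num) (by norm_num) (by norm_num) (by norm_num) le_rfl
    summable_zero summable_zero⟩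

end Summit.QuantumFields.YangMills.BalabanUVNodes.N19BudgetRoadAtRecord11

end
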